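import Summits.ValiantsHypothesis.ValiantsHypothesis.Theorems.SymPencilSdcPerFourCellTwelveFourClosed
import Summits.ValiantsHypothesis.ValiantsHypothesis.Theorems.SymPencilPerFourOneRowDefectThreeKernel

/-!
# Route `SymPencil` — the cell `(12, 4, 3)` of the size-`28` kernel-package table is EMPTY
# (`--supports` stmt-ValiantsHypothesis-5674 `SdcSuperquadratic`; m = 28 table, row `r = 12`;
# rung currency only — nothing here bears on `VP ≠ VNP`)

The landed cell `(12, 4, 2)` of the size-`27` table (`…CellTwelveFour` +
`…HyperplaneFlowCellOfCore` + `…CellTwelveFourClosed`, val-lit-p4 g14 / g15: a TWO-square defect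
family along the `4`-dimensional kernel ⇒ kernel = one row or one column ⇒ hyperplane-flow
rigidity of `per [𝟙; ·]` kills it) carries VERBATIM to size `28`: at `m = 28` the defect family
has THREE squares (`…HessianBlocks.perm_two_blocks_of_sum_sq_swap` needs `< 4`) and the package
has `|ι'| = 27 ≤ 2·12 + 3` (`…OneRowDefectThreeKernel`, the `+ 3` reading of the invariant
extension).  Theorems: `false_of_row_kernel_of_rigid` / `false_of_col_kernel_of_rigid` (defect
`≤ 3`), `false_of_rank_twelve_le_twentyEight_of_rigid`, `…_of_pencilCore`, and
**`false_of_rank_twelve_le_twentyEight`** (`IsAlgClosed`, binders exactly as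
`…CellTwelveFourClosed.false_of_rank_twelve_le_twentySeven` with `hm : m ≤ 28`) — row `r = 12` of
the size-`28` table (m = 28 table audit, val-lit-p6 g17, cell bus 2026-08-29 02:26Z/02:27Z).

Honest framing: ONE of the six rows (`r = 8, …, 13`) of the size-`28` table; the rows `r = 9, 10,
11, 13` are NOT in the tree at `m = 28` and `r = 8` is conditional on the coverage theorem, so NO
statement about `sdc(per_4)` follows here; `28 ≤ sdc(per_4) ≤ 29` of record, the crux
`SdcSuperquadratic` and `VP ≠ VNP` untouched.  Credit: mathematics and proof text are val-lit-p4
g14/g15's; this file only moves the size bound.  No definitions, no named facts. [folklore]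
-/

noncomputable section

-- single-conjunct layout: Sub = Summit, duplicated namespace component intended
set_option linter.dupNamespace false

namespace Summit.ValiantsHypothesis.ValiantsHypothesis.Theorems.SymPencilSdcPerFourCellTwelveFourTwentyEight

open Matrix MvPolynomial Module
open Literature.Computability.AlgebraicComplexity
open Summit.ValiantsHypothesis.ValiantsHypothesis.Theorems.SymPencilPerFourBasePointPackage
open Summit.ValiantsHypothesis.ValiantsHypothesis.Theorems.SymPencilPerFourOneRowCells
open Summit.ValiantsHypothesis.ValiantsHypothesis.Theorems.SymPencilIsotropicKernelSquaresBilinear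
open Summit.ValiantsHypothesis.ValiantsHypothesis.Theorems.SymPencilPerFourHessianBlocks
open Summit.ValiantsHypothesis.ValiantsHypothesis.Theorems.SymPencilPerFourBlocksEq
open Summit.ValiantsHypothesis.ValiantsHypothesis.Theorems.SymPencilSdcPerFourTwentySeven
open Summit.ValiantsHypothesis.ValiantsHypothesis.Theorems.SymPencilPerFourOneRowDefectTwoEndgame
open Summit.ValiantsHypothesis.ValiantsHypothesis.Theorems.SymPencilBasePointDetConst
open Summit.ValiantsHypothesis.ValiantsHypothesis.Theorems.SymPencilPerFourBoxNonvanishing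
open Summit.ValiantsHypothesis.ValiantsHypothesis.Theorems.SymPencilPerFourHyperplanePencilZeroOne
open Summit.ValiantsHypothesis.ValiantsHypothesis.Theorems.SymPencilPerFourHyperplaneFlow
  hiding false_of_rank_twelve_le_twentySeven_of_pencilCore
open Summit.ValiantsHypothesis.ValiantsHypothesis.Theorems.SymPencilPerFourOneRowDefectThreeKernel

universe u

variable {K : Type u} [Field K] [CharZero K] {ι' : Type*} [Fintype ι'] [DecidableEq ι']

/-- (Defect `≤ 3` restatement, proof verbatim.) **The one-ROW kernel cell at defect `≤ 2` is empty, given hyperplane flow rigidity of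
`per [𝟙; ·]`.**  See the module docstring. [folklore] -/
theorem false_of_row_kernel_of_rigid {D : Matrix ι' ι' K} (hD : IsUnit D.det) (hDs : Dᵀ = D)
    (bL : (Fin 4 × Fin 4 → K) →ₗ[K] (ι' → K))
    (CL : (Fin 4 × Fin 4 → K) →ₗ[K] Matrix ι' ι' K) (hCs : ∀ z, (CL z)ᵀ = CL z)
    {κ : K} (hκ : κ ≠ 0)
    (hiii : ∀ z, D.det * (bL z ⬝ᵥ (D⁻¹ * CL z * D⁻¹ * CL z * D⁻¹) *ᵥ bL z) =
      -(κ * MvPolynomial.eval z (perPoly (Fin 4) K)))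
    (hN : ∀ v, bL v = 0 → IsUnit (D + CL v).det ∧ ∀ (z : Fin 4 × Fin 4 → K) (s : K),
      κ * MvPolynomial.eval (v + s • z) (perPoly (Fin 4) K) =
        (Matrix.fromBlocks ((s * 0) • (1 : Matrix Unit Unit K))
          (Matrix.replicateRow Unit (s • bL z)) (Matrix.replicateCol Unit (s • bL z))
          (D + CL v + s • CL z)).det)
    (hdef : Fintype.card ι' ≤ 2 * finrank K (LinearMap.range bL) + 3)
    (hdet : ∀ v, bL v = 0 → ∀ t : K, (D + t • CL v).det = D.det)
    (hrig : ∀ (X : (Fin 3 → Fin 4 → K) →ₗ[K] (Fin 3 → Fin 4 → K))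
      (ℓ : (Fin 3 → Fin 4 → K) →ₗ[K] K),
      (∀ y, ℓ y = 0 → ∀ t : K,
        (Matrix.of ![fun _ => (1 : K), (y + t • X y) 0, (y + t • X y) 1,
            (y + t • X y) 2]).permanent =
          (Matrix.of ![fun _ => (1 : K), y 0, y 1, y 2]).permanent) →
      ∃ y, ℓ y = 0 ∧ X y = 0 ∧ (Matrix.of ![fun _ => (1 : K), y 0, y 1, y 2]).permanent ≠ 0)
    (l : Fin 4) (hrow : ∀ x, bL x = 0 → ∀ i j, i ≠ l → x (i, j) = 0)
    (hk4 : finrank K (LinearMap.ker bL) = 4) : False := by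
  classical
  -- the embeddings of the row `l` and of the other rows (as in `SymPencilPerFourOneRowCells`)
  let embV : (Fin 4 → K) →ₗ[K] (Fin 4 × Fin 4 → K) :=
    { toFun := fun w p => if p.1 = l then w p.2 else 0
      map_add' := fun w w' => by
        funext p; simp only [Pi.add_apply]; split_ifs <;> simp
      map_smul' := fun c w => by
        funext p; simp only [Pi.smul_apply, smul_eq_mul, RingHom.id_apply]; split_ifs <;> simp }
  have hembV : ∀ w p, embV w p = if p.1 = l then w p.2 else 0 := fun _ _ => rfl
  let σ := finSuccAboveEquiv l
  have hσ : ∀ a (h : l.succAbove a ≠ l), σ.symm ⟨l.succAbove a, h⟩ = a := fun a h => by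
    rw [Equiv.symm_apply_eq]; exact Subtype.ext (finSuccAboveEquiv_apply l a ▸ rfl)
  let embX : (Fin 3 → Fin 4 → K) →ₗ[K] (Fin 4 × Fin 4 → K) :=
    { toFun := fun x p => if h : p.1 = l then 0 else x (σ.symm ⟨p.1, h⟩) p.2
      map_add' := fun x x' => by
        funext p; simp only [Pi.add_apply]; split_ifs <;> simp
      map_smul' := fun c x => by
        funext p; simp only [Pi.smul_apply, smul_eq_mul, RingHom.id_apply]; split_ifs <;> simp }
  have hembXl : ∀ x j, embX x (l, j) = 0 := fun x j => by
    show (if h : ((l, j) : Fin 4 × Fin 4).1 = l then (0 : K) else _) = 0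
    rw [dif_pos rfl]
  have hembXa : ∀ x a j, embX x (l.succAbove a, j) = x a j := fun x a j => by
    have hne : l.succAbove a ≠ l := Fin.succAbove_ne l a
    show (if h : ((l.succAbove a, j) : Fin 4 × Fin 4).1 = l then (0 : K) else
      x (σ.symm ⟨(l.succAbove a, j).1, h⟩) (l.succAbove a, j).2) = x a j
    rw [dif_neg hne, hσ a hne]
  have hdecomp : ∀ z : Fin 4 × Fin 4 → K,
      z = embV (fun j => z (l, j)) + embX (fun a j => z (l.succAbove a, j)) := by
    intro z
    funext ⟨i, j⟩
    rcases Fin.eq_self_or_eq_succAbove l i with rfl | ⟨a, rfl⟩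
    · rw [Pi.add_apply, hembXl, hembV, if_pos rfl, add_zero]
    · rw [Pi.add_apply, hembXa, hembV, if_neg (Fin.succAbove_ne _ a), zero_add]
  have hker_le : LinearMap.ker bL ≤ LinearMap.range embV := by
    intro x hx
    refine ⟨fun j => x (l, j), ?_⟩
    funext ⟨i, j⟩
    rw [hembV]
    split_ifs with h
    · simp only at h; rw [h]
    · exact (hrow x (LinearMap.mem_ker.1 hx) i j h).symm
  have hker_eq : LinearMap.ker bL = LinearMap.range embV := by
    refine Submodule.eq_of_le_of_finrank_le hker_le ?_
    rw [hk4]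
    exact (LinearMap.finrank_range_le embV).trans (by simp)
  have hEV : ∀ w, bL (embV w) = 0 := fun w =>
    LinearMap.mem_ker.1 (hker_eq ▸ LinearMap.mem_range_self embV w)
  have hEXr : ∀ z, ∃ x, bL (embX x) = bL z := fun z =>
    ⟨fun a j => z (l.succAbove a, j), by
      conv_rhs => rw [hdecomp z]
      rw [map_add, hEV, zero_add]⟩
  have hper : ∀ (w : Fin 4 → K) (x : Fin 3 → Fin 4 → K) (s : K),
      MvPolynomial.eval (embV w + s • embX x) (perPoly (Fin 4) K) =
        s ^ 3 * (Matrix.of ![w, x 0, x 1, x 2]).permanent := by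
    intro w x s
    rw [eval_perPoly]
    refine permanent_of_row_data l _ w x s (fun j => ?_) (fun a j => ?_)
    · rw [Matrix.of_apply, Pi.add_apply, Pi.smul_apply, hembV, if_pos rfl, hembXl, smul_zero,
        add_zero]
    · rw [Matrix.of_apply, Pi.add_apply, Pi.smul_apply, hembV, if_neg (Fin.succAbove_ne l a),
        hembXa, smul_eq_mul, zero_add]
  -- the base row `𝟙`: affine, determinant constant
  have haff : ∀ z, ∃ e₀ e₁ : K, ∀ s : K,
      MvPolynomial.eval (z + s • embV fun _ => (1 : K)) (perPoly (Fin 4) K) = e₀ + s * e₁ :=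
    fun z => affine_of_row K l (embV fun _ => 1) (fun i j hi => by rw [hembV, if_neg hi]) z
  obtain ⟨Γ, M, hflow, hE1⟩ := exists_flow_identities hD hDs bL CL hCs hκ hiii hN hdef embV embX
    hEV hEXr hper (fun _ => 1) haff (hdet _ (hEV _))
  exact false_of_flow_identities (fun _ => (1 : K)) Γ M hD.ne_zero hκ hflow hE1 hrig

/-- (Defect `≤ 3` restatement, proof verbatim.) **The one-COLUMN kernel cell at defect `≤ 2` is empty, given hyperplane flow rigidity of
`per [𝟙; ·]`.** [folklore] -/
theorem false_of_col_kernel_of_rigid {D : Matrix ι' ι' K} (hD : IsUnit D.det) (hDs : Dᵀ = D)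
    (bL : (Fin 4 × Fin 4 → K) →ₗ[K] (ι' → K))
    (CL : (Fin 4 × Fin 4 → K) →ₗ[K] Matrix ι' ι' K) (hCs : ∀ z, (CL z)ᵀ = CL z)
    {κ : K} (hκ : κ ≠ 0)
    (hiii : ∀ z, D.det * (bL z ⬝ᵥ (D⁻¹ * CL z * D⁻¹ * CL z * D⁻¹) *ᵥ bL z) =
      -(κ * MvPolynomial.eval z (perPoly (Fin 4) K)))
    (hN : ∀ v, bL v = 0 → IsUnit (D + CL v).det ∧ ∀ (z : Fin 4 × Fin 4 → K) (s : K),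
      κ * MvPolynomial.eval (v + s • z) (perPoly (Fin 4) K) =
        (Matrix.fromBlocks ((s * 0) • (1 : Matrix Unit Unit K))
          (Matrix.replicateRow Unit (s • bL z)) (Matrix.replicateCol Unit (s • bL z))
          (D + CL v + s • CL z)).det)
    (hdef : Fintype.card ι' ≤ 2 * finrank K (LinearMap.range bL) + 3)
    (hdet : ∀ v, bL v = 0 → ∀ t : K, (D + t • CL v).det = D.det)
    (hrig : ∀ (X : (Fin 3 → Fin 4 → K) →ₗ[K] (Fin 3 → Fin 4 → K))
      (ℓ : (Fin 3 → Fin 4 → K) →ₗ[K] K),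
      (∀ y, ℓ y = 0 → ∀ t : K,
        (Matrix.of ![fun _ => (1 : K), (y + t • X y) 0, (y + t • X y) 1,
            (y + t • X y) 2]).permanent =
          (Matrix.of ![fun _ => (1 : K), y 0, y 1, y 2]).permanent) →
      ∃ y, ℓ y = 0 ∧ X y = 0 ∧ (Matrix.of ![fun _ => (1 : K), y 0, y 1, y 2]).permanent ≠ 0)
    (c : Fin 4) (hcol : ∀ x, bL x = 0 → ∀ i j, j ≠ c → x (i, j) = 0)
    (hk4 : finrank K (LinearMap.ker bL) = 4) : False := by
  classical
  let embV : (Fin 4 → K) →ₗ[K] (Fin 4 × Fin 4 → K) :=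
    { toFun := fun w p => if p.2 = c then w p.1 else 0
      map_add' := fun w w' => by
        funext p; simp only [Pi.add_apply]; split_ifs <;> simp
      map_smul' := fun c w => by
        funext p; simp only [Pi.smul_apply, smul_eq_mul, RingHom.id_apply]; split_ifs <;> simp }
  have hembV : ∀ w p, embV w p = if p.2 = c then w p.1 else 0 := fun _ _ => rfl
  let σ := finSuccAboveEquiv c
  have hσ : ∀ a (h : c.succAbove a ≠ c), σ.symm ⟨c.succAbove a, h⟩ = a := fun a h => by
    rw [Equiv.symm_apply_eq]; exact Subtype.ext (finSuccAboveEquiv_apply c a ▸ rfl)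
  let embX : (Fin 3 → Fin 4 → K) →ₗ[K] (Fin 4 × Fin 4 → K) :=
    { toFun := fun x p => if h : p.2 = c then 0 else x (σ.symm ⟨p.2, h⟩) p.1
      map_add' := fun x x' => by
        funext p; simp only [Pi.add_apply]; split_ifs <;> simp
      map_smul' := fun c x => by
        funext p; simp only [Pi.smul_apply, smul_eq_mul, RingHom.id_apply]; split_ifs <;> simp }
  have hembXc : ∀ x i, embX x (i, c) = 0 := fun x i => by
    show (if h : ((i, c) : Fin 4 × Fin 4).2 = c then (0 : K) else _) = 0
    rw [dif_pos rfl]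
  have hembXa : ∀ x a i, embX x (i, c.succAbove a) = x a i := fun x a i => by
    have hne : c.succAbove a ≠ c := Fin.succAbove_ne c a
    show (if h : ((i, c.succAbove a) : Fin 4 × Fin 4).2 = c then (0 : K) else
      x (σ.symm ⟨(i, c.succAbove a).2, h⟩) (i, c.succAbove a).1) = x a i
    rw [dif_neg hne, hσ a hne]
  have hdecomp : ∀ z : Fin 4 × Fin 4 → K,
      z = embV (fun i => z (i, c)) + embX (fun a i => z (i, c.succAbove a)) := by
    intro z
    funext ⟨i, j⟩
    rcases Fin.eq_self_or_eq_succAbove c j with rfl | ⟨a, rfl⟩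
    · rw [Pi.add_apply, hembXc, hembV, if_pos rfl, add_zero]
    · rw [Pi.add_apply, hembXa, hembV, if_neg (Fin.succAbove_ne _ a), zero_add]
  have hker_le : LinearMap.ker bL ≤ LinearMap.range embV := by
    intro x hx
    refine ⟨fun i => x (i, c), ?_⟩
    funext ⟨i, j⟩
    rw [hembV]
    split_ifs with h
    · simp only at h; rw [h]
    · exact (hcol x (LinearMap.mem_ker.1 hx) i j h).symm
  have hker_eq : LinearMap.ker bL = LinearMap.range embV := by
    refine Submodule.eq_of_le_of_finrank_le hker_le ?_
    rw [hk4]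
    exact (LinearMap.finrank_range_le embV).trans (by simp)
  have hEV : ∀ w, bL (embV w) = 0 := fun w =>
    LinearMap.mem_ker.1 (hker_eq ▸ LinearMap.mem_range_self embV w)
  have hEXr : ∀ z, ∃ x, bL (embX x) = bL z := fun z =>
    ⟨fun a i => z (i, c.succAbove a), by
      conv_rhs => rw [hdecomp z]
      rw [map_add, hEV, zero_add]⟩
  have hper : ∀ (w : Fin 4 → K) (x : Fin 3 → Fin 4 → K) (s : K),
      MvPolynomial.eval (embV w + s • embX x) (perPoly (Fin 4) K) =
        s ^ 3 * (Matrix.of ![w, x 0, x 1, x 2]).permanent := by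
    intro w x s
    rw [eval_perPoly]
    refine permanent_of_col_data c _ w x s (fun i => ?_) (fun a i => ?_)
    · rw [Matrix.of_apply, Pi.add_apply, Pi.smul_apply, hembV, if_pos rfl, hembXc, smul_zero,
        add_zero]
    · rw [Matrix.of_apply, Pi.add_apply, Pi.smul_apply, hembV, if_neg (Fin.succAbove_ne c a),
        hembXa, smul_eq_mul, zero_add]
  have haff : ∀ z, ∃ e₀ e₁ : K, ∀ s : K,
      MvPolynomial.eval (z + s • embV fun _ => (1 : K)) (perPoly (Fin 4) K) = e₀ + s * e₁ :=
    fun z => affine_of_col K c (embV fun _ => 1) (fun i j hj => by rw [hembV, if_neg hj]) z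
  obtain ⟨Γ, M, hflow, hE1⟩ := exists_flow_identities hD hDs bL CL hCs hκ hiii hN hdef embV embX
    hEV hEXr hper (fun _ => 1) haff (hdet _ (hEV _))
  exact false_of_flow_identities (fun _ => (1 : K)) Γ M hD.ne_zero hκ hflow hE1 hrig

variable (K)

/-- (`m ≤ 28`, three-square defect family; proof verbatim otherwise.) **The size-`27` cell `(12,4,2)` is empty, given hyperplane flow rigidity of `per [𝟙; ·]`**
(algebraically closed field of characteristic `0`): in the base-point package of a symmetric affine
determinantal representation of `per_4` of size `m ≤ 27`, the space of kernel rows is not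
`12`-dimensional.  See the module docstring. [folklore] -/
theorem false_of_rank_twelve_le_twentyEight_of_rigid [IsAlgClosed K] {m : ℕ} (hm : m ≤ 28)
    {i₀ : Fin m} {D : Matrix {i // i ≠ i₀} {i // i ≠ i₀} K}
    {bL : (Fin 4 × Fin 4 → K) →ₗ[K] ({i // i ≠ i₀} → K)}
    {CL : (Fin 4 × Fin 4 → K) →ₗ[K] Matrix {i // i ≠ i₀} {i // i ≠ i₀} K} {κ : K}
    (hD : IsUnit D.det) (hDs : Dᵀ = D) (hCs : ∀ z, (CL z)ᵀ = CL z) (hκ : κ ≠ 0)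
    (hi : ∀ z, bL z ⬝ᵥ D⁻¹ *ᵥ bL z = 0)
    (hii : ∀ z, bL z ⬝ᵥ (D⁻¹ * CL z * D⁻¹) *ᵥ bL z = 0)
    (hiii : ∀ z, D.det * (bL z ⬝ᵥ (D⁻¹ * CL z * D⁻¹ * CL z * D⁻¹) *ᵥ bL z) =
      -(κ * eval z (perPoly (Fin 4) K)))
    (hcard : Fintype.card {i // i ≠ i₀} + 1 = m)
    (hrn : finrank K (LinearMap.range bL) + finrank K (LinearMap.ker bL) = 16)
    (hN : ∀ v, bL v = 0 → IsUnit (D + CL v).det ∧ ∀ (z : Fin 4 × Fin 4 → K) (s : K),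
      κ * eval (v + s • z) (perPoly (Fin 4) K) =
        (Matrix.fromBlocks ((s * 0) • (1 : Matrix Unit Unit K))
          (Matrix.replicateRow Unit (s • bL z)) (Matrix.replicateCol Unit (s • bL z))
          (D + CL v + s • CL z)).det)
    (hrig : ∀ (X : (Fin 3 → Fin 4 → K) →ₗ[K] (Fin 3 → Fin 4 → K))
      (ℓ : (Fin 3 → Fin 4 → K) →ₗ[K] K),
      (∀ y, ℓ y = 0 → ∀ t : K,
        (Matrix.of ![fun _ => (1 : K), (y + t • X y) 0, (y + t • X y) 1,
            (y + t • X y) 2]).permanent =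
          (Matrix.of ![fun _ => (1 : K), y 0, y 1, y 2]).permanent) →
      ∃ y, ℓ y = 0 ∧ X y = 0 ∧ (Matrix.of ![fun _ => (1 : K), y 0, y 1, y 2]).permanent ≠ 0)
    (h12 : finrank K (LinearMap.range bL) = 12) : False := by
  classical
  by_cases hm26 : m ≤ 26
  · exact false_of_rank_twelve_le_twentySix K hm26 hD hDs hCs hκ hi hii hiii hcard hrn hN h12
  have hk4 : finrank K (LinearMap.ker bL) = 4 := by omega
  have hdef : Fintype.card {i // i ≠ i₀} ≤ 2 * finrank K (LinearMap.range bL) + 3 := by omega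
  have hdet : ∀ v, bL v = 0 → ∀ t : K, (D + t • CL v).det = D.det := fun v hv t =>
    det_add_smul_eq_det_of_isAlgClosed D bL CL (fun v hv => (hN v hv).1) v hv t
  -- a TWO-square family along the kernel, so the kernel is one row or one column
  obtain ⟨c, β, hcβ⟩ := sum_sq_of_isotropic_defect_bilinear hD hDs bL CL hCs
    (fun z => eval z (perPoly (Fin 4) K)) hκ hi hii hiii 3 (by omega)
  have hB : ∀ y ∈ LinearMap.ker bL, ∀ i k j l : Fin 4, i ≠ k → j ≠ l →
      y (i, j) * y (k, l) + y (i, l) * y (k, j) = 0 := fun y hy =>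
    perm_two_blocks_of_sum_sq_swap (ι := Fin 3) (by simp) y
      ⟨c, fun k => (β k).flip y, fun u => by
        obtain ⟨e₀, e₁, he⟩ := hcβ u y (LinearMap.mem_ker.1 hy)
        exact ⟨e₀, e₁, fun s => by simpa only [LinearMap.flip_apply] using he s⟩⟩
  rcases row_or_col_of_perm_two_blocks (LinearMap.ker bL) hB hk4 with ⟨l, hl⟩ | ⟨c', hc'⟩
  · exact false_of_row_kernel_of_rigid hD hDs bL CL hCs hκ hiii hN hdef hdet hrig l
      (fun x hx => hl x (LinearMap.mem_ker.2 hx)) hk4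
  · exact false_of_col_kernel_of_rigid hD hDs bL CL hCs hκ hiii hN hdef hdet hrig c'
      (fun x hx => hc' x (LinearMap.mem_ker.2 hx)) hk4

/-- (`m ≤ 28` restatement.) **Cell `(12,4,2)` of the size-27 table is EMPTY MODULO S1c** (the one-row pencil core): the binder block of
`false_of_rank_twelve_le_twentyEight_of_rigid` with `hrig` replaced by the
S1c statement. [folklore] -/
theorem false_of_rank_twelve_le_twentyEight_of_pencilCore [IsAlgClosed K] {m : ℕ} (hm : m ≤ 28)
    {i₀ : Fin m} {D : Matrix {i // i ≠ i₀} {i // i ≠ i₀} K}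
    {bL : (Fin 4 × Fin 4 → K) →ₗ[K] ({i // i ≠ i₀} → K)}
    {CL : (Fin 4 × Fin 4 → K) →ₗ[K] Matrix {i // i ≠ i₀} {i // i ≠ i₀} K} {κ : K}
    (hD : IsUnit D.det) (hDs : Dᵀ = D) (hCs : ∀ z, (CL z)ᵀ = CL z) (hκ : κ ≠ 0)
    (hi : ∀ z, bL z ⬝ᵥ D⁻¹ *ᵥ bL z = 0)
    (hii : ∀ z, bL z ⬝ᵥ (D⁻¹ * CL z * D⁻¹) *ᵥ bL z = 0)
    (hiii : ∀ z, D.det * (bL z ⬝ᵥ (D⁻¹ * CL z * D⁻¹ * CL z * D⁻¹) *ᵥ bL z) =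
      -(κ * eval z (perPoly (Fin 4) K)))
    (hcard : Fintype.card {i // i ≠ i₀} + 1 = m)
    (hrn : finrank K (LinearMap.range bL) + finrank K (LinearMap.ker bL) = 16)
    (hN : ∀ v, bL v = 0 → IsUnit (D + CL v).det ∧ ∀ (z : Fin 4 × Fin 4 → K) (s : K),
      κ * eval (v + s • z) (perPoly (Fin 4) K) =
        (Matrix.fromBlocks ((s * 0) • (1 : Matrix Unit Unit K))
          (Matrix.replicateRow Unit (s • bL z)) (Matrix.replicateCol Unit (s • bL z))
          (D + CL v + s • CL z)).det)
    (hS1c : ∀ (X₀ X₁ X₂ : (Fin 4 → K) →ₗ[K] (Fin 4 → K)) (μ : (Fin 4 → K) →ₗ[K] K), μ ≠ 0 →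
      (∀ (a b c : Fin 4 → K) (t : K), μ c = 0 →
        (Matrix.of ![(fun _ => (1 : K)), a + t • X₀ a, b + t • X₁ b, c + t • X₂ c]).permanent =
          (Matrix.of ![(fun _ => (1 : K)), a, b, c]).permanent) →
      ∃ φ : (Fin 4 → K) →ₗ[K] K, (∀ a, φ a = 0 → X₀ a = 0 ∧ X₁ a = 0) ∧ (∀ c, μ c = 0 → X₂ c = 0))
    (h12 : finrank K (LinearMap.range bL) = 12) : False :=
  false_of_rank_twelve_le_twentyEight_of_rigid K hm hD hDs hCs hκ hi hii hiii
    hcard hrn hN (rigid_of_pencilCore hS1c) h12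

/-- (`m ≤ 28`: **the cell `(12, 4, 3)` of the size-`28` table is empty.**) **Cell `(12,4,2)` of the size-27 table is EMPTY** (unconditional): the binder block of
`SymPencilSdcPerFourCellTwelveFour.false_of_rank_twelve_le_twentySeven_of_rigid` without `hrig`.
[folklore] -/
theorem false_of_rank_twelve_le_twentyEight [IsAlgClosed K] {m : ℕ} (hm : m ≤ 28)
    {i₀ : Fin m} {D : Matrix {i // i ≠ i₀} {i // i ≠ i₀} K}
    {bL : (Fin 4 × Fin 4 → K) →ₗ[K] ({i // i ≠ i₀} → K)}
    {CL : (Fin 4 × Fin 4 → K) →ₗ[K] Matrix {i // i ≠ i₀} {i // i ≠ i₀} K} {κ : K}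
    (hD : IsUnit D.det) (hDs : Dᵀ = D) (hCs : ∀ z, (CL z)ᵀ = CL z) (hκ : κ ≠ 0)
    (hi : ∀ z, bL z ⬝ᵥ D⁻¹ *ᵥ bL z = 0)
    (hii : ∀ z, bL z ⬝ᵥ (D⁻¹ * CL z * D⁻¹) *ᵥ bL z = 0)
    (hiii : ∀ z, D.det * (bL z ⬝ᵥ (D⁻¹ * CL z * D⁻¹ * CL z * D⁻¹) *ᵥ bL z) =
      -(κ * eval z (perPoly (Fin 4) K)))
    (hcard : Fintype.card {i // i ≠ i₀} + 1 = m)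
    (hrn : finrank K (LinearMap.range bL) + finrank K (LinearMap.ker bL) = 16)
    (hN : ∀ v, bL v = 0 → IsUnit (D + CL v).det ∧ ∀ (z : Fin 4 × Fin 4 → K) (s : K),
      κ * eval (v + s • z) (perPoly (Fin 4) K) =
        (Matrix.fromBlocks ((s * 0) • (1 : Matrix Unit Unit K))
          (Matrix.replicateRow Unit (s • bL z)) (Matrix.replicateCol Unit (s • bL z))
          (D + CL v + s • CL z)).det)
    (h12 : finrank K (LinearMap.range bL) = 12) : False :=
  false_of_rank_twelve_le_twentyEight_of_pencilCore K hm hD hDs hCs hκ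
    hi hii hiii hcard hrn hN
    (fun X₀ X₁ X₂ μ hμ hf => exists_kernel_hyperplane_of_pencil_flow X₀ X₁ X₂ μ hμ hf) h12

end Summit.ValiantsHypothesis.ValiantsHypothesis.Theorems.SymPencilSdcPerFourCellTwelveFourTwentyEight

end
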